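import Literature.AnabelianGeometry.EtaleTheta.ConstantMultipleRigidityEquivarianceProofs
import Literature.AnabelianGeometry.EtaleTheta.ConstantMultipleRigidityUniqueProofs
import Literature.AnabelianGeometry.EtaleTheta.Discharge.Sec1DeckSign
import Literature.AnabelianGeometry.EtaleTheta.Discharge.Sec1SingleClassValueLaw
import HarnessLib

/-!
# [EtTh] Thm. 1.10 (i), uniqueness clause — a CLASS-LEVEL route: `Thm110iUnique` from Prop. 1.5 (iii)
# evaluated at the two given points `τ`, `τ⁻¹` (K2 sub-DAG row r8″, holder abc-iut-w5-d140)

S. Mochizuki, *The étale theta function …*, Publ. RIMS 45 (2009), §1: Prop. 1.5 (iii) p.249 («on which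
`a ∈ Z ≅ Π^tp_X/Π^tp_Y` acts as follows: `η̈^Θ ↦ η̈^Θ − 2a·log(Ü) − (a²/2)·log(q_X) + log(O^×_K̈)`»),
Def. 1.9 p.255, Thm. 1.10 (i) p.255 («a property that determines this collection of classes up to
multiplication by ±1») [cite: MochizukiEtTh2009, Thm 1.10 (i) p.29].  PROOF-ONLY companion (no `def`)
of `ConstantMultipleRigidity.lean` (abc-iut-L2-t1) — cell sub-DAG plan/L2/SUBDAG-EtTh-Thm110.md.

THE ROUTE.  The landed junction `MuTwoSetting.thm110iUnique_of_referenceClass_of_prop15ii` (p420097,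
abc-iut-L2-t6) goes through print's «series representation» at the TRANSLATED points `σ^{−a}·τ` and so
needs (B2) an orbit generator (ε_μ-parity clause P-C8), (B3) naturality of evaluation (G-L2t6g4-1) and
(B4) the reference-class value law at infinitely many points (G-L2t6g4-2).  Here everything is evaluated
at the two GIVEN points only: by the typed FACT `Prop15iii` (FACT-LIST F-0591) the orbit is known at
the level of CLASSES — for EVERY `σ ∈ Π^tp_X` of degree `a = toZ σ`,
`σ·x = x · log(Ü)^{−2a} · κ(q̈)^{−a²} · κ(u_σ)`, `u_σ ∈ O^×_K̈` (`exists_unit_conj_eq_of_prop15iii`) —,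
so at a point `y` whose evaluation of `log(Ü)` is the coordinate `Ü(y)` (the ANCHOR equation
`evalAt_y(log Ü|_y) = Ü(y)`; the printed meaning of «the coordinate of `y`», abc-iut-L2-t1's
`AnchoredPoint.evalAt_logUdd`) the values of the orbit are
`value(σ·x) = value(x) · Ü(y)^{−2a} · q̈^{−a²} · u_σ` (`exists_evalAt_conj_eq`); with `Ü(y)² = −1` their
absolute values are `‖q̈‖^{−a²} · ‖value(x)‖`, minimal exactly at `a = 0`, where the value is
`± value(x)` (`σ ∈ Π^tp_Y` ⇒ `σ² ∈ Π^tp_Ÿ` acts trivially and `κ(u_σ)` is `σ`-invariant by Prop. 1.5 (ii)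
via abc-iut-w5-d234's `MuTwoSetting.conj_inflTheta_kumYdd_eq_self`, so `u_σ² = 1`).  Hence standard
type pins `value(x)` to `±1` at `τ` or at `τ⁻¹` (`exists_value_eq_sign_of_isOfStandardType`), and
**`thm110iUnique_of_prop15iii`**: `Thm110iUnique hC hZ E S` from
{ FACT `Prop15ii` (F-2503), FACT `Prop15iii` (F-0591), the anchor equations at `τ` and `τ⁻¹`, and ONE
sign relation `value_{τ⁻¹}(η̈) = ± value_τ(η̈)` (print: `Θ̈(−√−1) = −Θ̈(√−1)`, Prop. 1.4 (ii)) } —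
no orbit generator, no ε_μ clause, no evaluation naturality, no translated points, no value law.
HONEST FRAMING: typed ≠ proved for [EtTh]; the two facts are FACT-LIST hypotheses BY NAME, the three
equations are explicit binders about the two points of Def. 1.9; nothing here bears on the disputed
[IUTchIII] Cor. 3.12.
-/

noncomputable section

namespace Literature.AnabelianGeometry.EtaleTheta

open Literature.AnabelianGeometry.SemiGraphs

variable {p : ℕ} [Fact p.Prime]

/-! ### Prop. 1.5 (iii) at the level of `H¹(Π^tp_Ÿ, Δ_Θ)` and at an anchored point -/

namespace ThetaSetting

namespace EtaleThetaData

variable {D : ThetaSetting p} (E : D.EtaleThetaData)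

/-- **Prop. 1.5 (iii), pushed down to `H¹(Π^tp_Ÿ, Δ_Θ)`**: for every theta class `x` and EVERY
`σ ∈ Π^tp_X` of degree `a = toZ σ` there is a unit `u ∈ O^×_K̈` with
`σ·x = x · infl(log Ü)^{−2a} · infl κ(q̈)^{−a²} · infl κ(u)` (inflation commutes with conjugation,
`ContH1.infl_conj`). [cite: MochizukiEtTh2009, Prop 1.5 (iii) p.23] -/
theorem exists_unit_conj_eq_of_prop15iii (hC : D.Compat) (h15 : Prop15iii E hC)
    {x : D.H1 D.GtpYdd} (hx : x ∈ E.thetaClasses) (σ : D.PiTemp) :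
    ∃ u ∈ D.unitsOKdd,
      haveI := hC.GtpYdd_normal
      ContH1.conj D.toTheta D.DeltaTheta σ x =
        x * D.inflTheta D.GtpYdd E.logUdd ^ (-(2 * Multiplicative.toAdd (D.toZ σ)))
          * D.inflTheta D.GtpYdd (E.kumYdd (E.toKddHat D.qddUnit)) ^
              (-(Multiplicative.toAdd (D.toZ σ) * Multiplicative.toAdd (D.toZ σ)))
          * D.inflTheta D.GtpYdd (E.kumYdd (E.toKddHat u)) := by
  haveI := hC.GtpYdd_normal
  haveI := hC.GtpYddTheta_normal
  obtain ⟨x', ⟨hx', -, hΦ⟩, -⟩ := h15 x hx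
  obtain ⟨u, hu, h⟩ := hΦ σ
  refine ⟨u, hu, ?_⟩
  have e1 : ContH1.conj D.toTheta D.DeltaTheta σ x =
      D.inflTheta D.GtpYdd (ContH1.conj (MonoidHom.id D.GtpTheta) D.DeltaTheta (D.toTheta σ) x') := by
    rw [← hx']
    exact (ContH1.infl_conj (H₀ := D.GtpYdd) (H' := D.GtpYdd.map D.toTheta)
      (hψ := D.continuous_toTheta) le_rfl σ x').symm
  rw [e1, h, map_mul, map_mul, map_mul, map_zpow, map_zpow, hx']

/-- **The orbit VALUES at an anchored point**: if `y` evaluates `log(Ü)` to its coordinate `Ü(y)` (the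
anchor equation), then for every theta class `x` and every `σ ∈ Π^tp_X` of degree `a`,
`value_y(σ·x) = value_y(x) · (Ü(y)^{−2a} · q̈^{−a²} · u_σ)` with `u_σ ∈ O^×_K̈` (`evalAt_kum`).
[cite: MochizukiEtTh2009, Def 1.9 (i) p.29] -/
theorem exists_evalAt_conj_eq (hC : D.Compat) (h15 : Prop15iii E hC)
    {x : D.H1 D.GtpYdd} (hx : x ∈ E.thetaClasses) (y : NonCuspidalPoint E.toKummerData)
    (hL : y.evalAt (ContH1.res D.toTheta D.DeltaTheta y.Dpt_le (D.inflTheta D.GtpYdd E.logUdd)) =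
      E.toKddHat y.coord)
    (σ : D.PiTemp) :
    ∃ u ∈ D.unitsOKdd,
      haveI := hC.GtpYdd_normal
      y.evalAt (ContH1.res D.toTheta D.DeltaTheta y.Dpt_le (ContH1.conj D.toTheta D.DeltaTheta σ x)) =
        y.evalAt (ContH1.res D.toTheta D.DeltaTheta y.Dpt_le x) *
          E.toKddHat (y.coord ^ (-(2 * Multiplicative.toAdd (D.toZ σ))) *
            D.qddUnit ^ (-(Multiplicative.toAdd (D.toZ σ) * Multiplicative.toAdd (D.toZ σ))) * u) := by
  haveI := hC.GtpYdd_normal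
  obtain ⟨u, hu, h⟩ := E.exists_unit_conj_eq_of_prop15iii hC h15 hx σ
  refine ⟨u, hu, ?_⟩
  rw [h, map_mul, map_mul, map_mul, map_mul, map_mul, map_mul, map_zpow, map_zpow, map_zpow,
    map_zpow, hL, y.evalAt_kum, y.evalAt_kum, map_mul, map_mul, map_zpow, map_zpow]
  simp only [mul_assoc]

end EtaleThetaData

end ThetaSetting

namespace MuTwoSetting

variable {M : MuTwoSetting p} {E : M.toThetaSetting.EtaleThetaData}

/-! ### Degree `0`: the involution argument (Prop. 1.5 (ii)) -/

/-- **Degree-`0` elements move a theta class by `±1`**: for `σ ∈ Π^tp_Y` (`toZ σ = 0`) there is a unit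
`u` with `u = ±1` and `σ·x = x · infl κ(u)` — Prop. 1.5 (iii) at `a = 0` plus the involution argument
(`σ² ∈ Π^tp_Ÿ` acts trivially, `[Π^tp_Y : Π^tp_Ÿ] = 2`; `infl κ(u)` is `σ`-invariant by Prop. 1.5 (ii), `K = K̈`).
[cite: MochizukiEtTh2009, Prop 1.5 (iii) p.23] -/
theorem exists_sign_conj_eq_of_toZ_eq_one (hC : M.toThetaSetting.Compat)
    (h15ii : ThetaSetting.Prop15ii E.toKummerData hC) (h15iii : ThetaSetting.Prop15iii E hC)
    {x : M.toThetaSetting.H1 M.toThetaSetting.GtpYdd} (hx : x ∈ E.thetaClasses)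
    {σ : M.PiTemp} (hσ : M.toZ σ = 1) :
    ∃ u ∈ M.toThetaSetting.unitsOKdd,
      (((u : M.Kdd) : PadicAlgCl p) = 1 ∨ ((u : M.Kdd) : PadicAlgCl p) = -1) ∧
      haveI := hC.GtpYdd_normal
      ContH1.conj M.toTheta M.toThetaSetting.DeltaTheta σ x =
        x * M.toThetaSetting.inflTheta M.toThetaSetting.GtpYdd (E.kumYdd (E.toKddHat u)) := by
  haveI := hC.GtpYdd_normal
  obtain ⟨u, hu, h⟩ := E.exists_unit_conj_eq_of_prop15iii hC h15iii hx σ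
  have h0 : Multiplicative.toAdd (M.toZ σ) = 0 := by rw [hσ, toAdd_one]
  rw [h0] at h
  simp only [mul_zero, neg_zero, zpow_zero, mul_one] at h
  refine ⟨u, hu, ?_, h⟩
  -- the involution argument
  set κ := M.toThetaSetting.inflTheta M.toThetaSetting.GtpYdd (E.kumYdd (E.toKddHat u)) with hκ
  have hσY : σ ∈ M.GtpY := hσ
  have hσ2 : σ * σ ∈ M.toThetaSetting.GtpYdd := by
    have h2 : (M.toThetaSetting.GtpYdd.subgroupOf M.GtpY).index = 2 := M.relIndex_GtpYdd_GtpY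
    have := Subgroup.mul_self_mem_of_index_two h2 ⟨σ, hσY⟩
    rw [Subgroup.mem_subgroupOf] at this
    exact this
  have hfix : ContH1.conj M.toTheta M.toThetaSetting.DeltaTheta σ κ = κ :=
    M.conj_inflTheta_kumYdd_eq_self hC E.toKummerData σ u (by rw [h15ii.Fdd2_eq]; exact ⟨_, rfl⟩)
  have h2 : x = x * κ * κ := by
    conv_lhs => rw [← ContH1.conj_eq_self_of_mem (φ := M.toTheta) (A := M.toThetaSetting.DeltaTheta)
      (σ * σ) hσ2 x, ContH1.conj_mul_apply, h, map_mul, h, hfix]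
  have hκ2 : κ ^ 2 = 1 := by
    have h3 : x * (κ * κ) = x * 1 := by rw [mul_one, ← mul_assoc]; exact h2.symm
    rw [sq]
    exact mul_left_cancel h3
  have hu2 : u ^ 2 = 1 := by
    have hinj : (M.toThetaSetting.inflTheta M.toThetaSetting.GtpYdd) (E.kumYdd (E.toKddHat (u ^ 2))) =
        (M.toThetaSetting.inflTheta M.toThetaSetting.GtpYdd) (E.kumYdd (E.toKddHat 1)) := by
      rw [map_pow, map_pow, map_pow, ← hκ, hκ2, map_one, map_one, map_one]
    exact E.toKddHat_injective (E.kumYdd_injective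
      (M.toThetaSetting.inflTheta_injective M.toThetaSetting.GtpYdd hinj))
  exact ThetaSetting.coe_eq_one_or_eq_neg_one_of_sq_eq_one hu2
/-! ### The values of the orbit at an anchored point -/

/-- Coercion `K̈^× → ℚ̄_p` commutes with inversion (bookkeeping). [cite: MochizukiEtTh2009, §1 p.17] -/
theorem coe_units_inv' (v : (↥M.Kdd)ˣ) :
    (((v⁻¹ : (↥M.Kdd)ˣ) : M.Kdd) : PadicAlgCl p) = (((v : M.Kdd) : PadicAlgCl p))⁻¹ := by
  push_cast; rfl

/-- Coercion `K̈^× → ℚ̄_p` commutes with integer powers (bookkeeping). [cite: MochizukiEtTh2009, §1 p.17] -/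
theorem coe_units_zpow' (v : (↥M.Kdd)ˣ) (n : ℤ) :
    (((v ^ n : (↥M.Kdd)ˣ) : M.Kdd) : PadicAlgCl p) = (((v : M.Kdd) : PadicAlgCl p)) ^ n := by
  push_cast; rfl

/-- A unit of `K̈` is nonzero in `ℚ̄_p` (bookkeeping). [cite: MochizukiEtTh2009, §1 p.17] -/
theorem coe_units_ne_zero (v : (↥M.Kdd)ˣ) : ((v : M.Kdd) : PadicAlgCl p) ≠ 0 := by
  intro h
  have : ((v : M.Kdd) : PadicAlgCl p) * (((v⁻¹ : (↥M.Kdd)ˣ) : M.Kdd) : PadicAlgCl p) = 1 := by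
    rw [← coe_units_mul, mul_inv_cancel]; rfl
  exact zero_ne_one (by rwa [h, zero_mul] at this)

/-- Signs multiply (private bookkeeping). [folklore] -/
private theorem sign_mul {a b : PadicAlgCl p} (ha : a = 1 ∨ a = -1) (hb : b = 1 ∨ b = -1) :
    a * b = 1 ∨ a * b = -1 := by
  rcases ha with rfl | rfl <;> rcases hb with rfl | rfl <;> norm_num

/-- Signs invert (private bookkeeping). [folklore] -/
private theorem sign_inv {a : PadicAlgCl p} (ha : a = 1 ∨ a = -1) : a⁻¹ = 1 ∨ a⁻¹ = -1 := by
  rcases ha with rfl | rfl <;> norm_num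

/-- Cancel a sign (private bookkeeping). [folklore] -/
private theorem sign_of_mul_sign {a b : PadicAlgCl p} (hb : b = 1 ∨ b = -1)
    (hab : a * b = 1 ∨ a * b = -1) : a = 1 ∨ a = -1 := by
  have : a = a * b * b := by rcases hb with rfl | rfl <;> ring
  rw [this]
  exact sign_mul hab hb

/-- A coordinate with `Ü(y)² = −1` has absolute value `1`. [cite: MochizukiEtTh2009, Def 1.9 p.29] -/
theorem norm_eq_one_of_sq_eq_neg_one {c : PadicAlgCl p} (hc : c ^ 2 = -1) : ‖c‖ = 1 := by
  have h : ‖c‖ ^ 2 = 1 := by rw [← norm_pow, hc, norm_neg, norm_one]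
  have h0 : 0 ≤ ‖c‖ := norm_nonneg c
  nlinarith [h, h0]

/-- **The values of the orbit `η̈^{Θ,ℤ}` at an anchored point, from Prop. 1.5 (iii)**: every value `w` of
the orbit of a theta class `x` at `y` is `value_y(x) · Ü(y)^{−2a} · q̈^{−a²} · u` for some degree `a ∈ ℤ`
and unit `u`, with `u = ±1` when `a = 0` (degree-`0` elements move `x` by a sign only).
[cite: MochizukiEtTh2009, Def 1.9 (i) p.29] -/
theorem exists_value_law (hC : M.toThetaSetting.Compat)
    (h15ii : ThetaSetting.Prop15ii E.toKummerData hC) (h15iii : ThetaSetting.Prop15iii E hC)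
    {x : M.toThetaSetting.H1 M.toThetaSetting.GtpYdd} (hx : x ∈ E.thetaClasses) (εZ : M.GtpC)
    (y : ThetaSetting.NonCuspidalPoint E.toKummerData)
    (hL : y.evalAt (ContH1.res M.toTheta M.toThetaSetting.DeltaTheta y.Dpt_le
      (M.toThetaSetting.inflTheta M.toThetaSetting.GtpYdd E.logUdd)) = E.toKddHat y.coord)
    {w : (↥M.Kdd)ˣ} (hw : w ∈ valuesAt hC εZ x y) :
    ∃ (a : ℤ) (u : (↥M.Kdd)ˣ), u ∈ M.toThetaSetting.unitsOKdd ∧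
      (a = 0 → ((u : M.Kdd) : PadicAlgCl p) = 1 ∨ ((u : M.Kdd) : PadicAlgCl p) = -1) ∧
      E.toKddHat w = y.evalAt (ContH1.res M.toTheta M.toThetaSetting.DeltaTheta y.Dpt_le x) *
        E.toKddHat (y.coord ^ (-(2 * a)) * M.toThetaSetting.qddUnit ^ (-(a * a)) * u) := by
  haveI := hC.GtpYdd_normal
  obtain ⟨_, ⟨σ, hσ, rfl⟩, hz⟩ := hw
  by_cases ha : Multiplicative.toAdd (M.toZ σ) = 0
  · have hσ1 : M.toZ σ = 1 := toAdd_eq_zero.mp ha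
    obtain ⟨u, hu, hpm, hconj⟩ := exists_sign_conj_eq_of_toZ_eq_one hC h15ii h15iii hx hσ1
    refine ⟨0, u, hu, fun _ => hpm, ?_⟩
    rw [← hz, hconj, map_mul, map_mul, y.evalAt_kum]
    simp only [mul_zero, neg_zero, zpow_zero, one_mul]
  · obtain ⟨u, hu, hev⟩ := E.exists_evalAt_conj_eq hC h15iii hx y hL σ
    exact ⟨Multiplicative.toAdd (M.toZ σ), u, hu, fun h => absurd h ha, by rw [← hz, hev]⟩

/-- If the orbit has a value at `y` at all, then `x` itself has a value `value_y(x) ∈ K̈^×` there.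
[cite: MochizukiEtTh2009, Def 1.9 (i) p.29] -/
theorem exists_eval_eq_toKddHat (hC : M.toThetaSetting.Compat)
    (h15ii : ThetaSetting.Prop15ii E.toKummerData hC) (h15iii : ThetaSetting.Prop15iii E hC)
    {x : M.toThetaSetting.H1 M.toThetaSetting.GtpYdd} (hx : x ∈ E.thetaClasses) (εZ : M.GtpC)
    (y : ThetaSetting.NonCuspidalPoint E.toKummerData)
    (hL : y.evalAt (ContH1.res M.toTheta M.toThetaSetting.DeltaTheta y.Dpt_le
      (M.toThetaSetting.inflTheta M.toThetaSetting.GtpYdd E.logUdd)) = E.toKddHat y.coord)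
    {w : (↥M.Kdd)ˣ} (hw : w ∈ valuesAt hC εZ x y) :
    ∃ v₀ : (↥M.Kdd)ˣ,
      y.evalAt (ContH1.res M.toTheta M.toThetaSetting.DeltaTheta y.Dpt_le x) = E.toKddHat v₀ := by
  obtain ⟨a, u, -, -, h⟩ := exists_value_law hC h15ii h15iii hx εZ y hL hw
  refine ⟨w * (y.coord ^ (-(2 * a)) * M.toThetaSetting.qddUnit ^ (-(a * a)) * u)⁻¹, ?_⟩
  rw [map_mul, map_inv, h, mul_inv_cancel_right]

/-- The value of `x` itself (degree `0`, `σ = 1`) belongs to the value set. [cite: MochizukiEtTh2009, Def 1.9 (i) p.29] -/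
theorem mem_valuesAt_of_eval_eq (hC : M.toThetaSetting.Compat) (εZ : M.GtpC)
    {x : M.toThetaSetting.H1 M.toThetaSetting.GtpYdd}
    (y : ThetaSetting.NonCuspidalPoint E.toKummerData) {v₀ : (↥M.Kdd)ˣ}
    (hv₀ : y.evalAt (ContH1.res M.toTheta M.toThetaSetting.DeltaTheta y.Dpt_le x) = E.toKddHat v₀) :
    v₀ ∈ valuesAt hC εZ x y := by
  haveI := hC.GtpYdd_normal
  refine ⟨x, ⟨1, by rw [map_one]; exact one_mem _, ?_⟩, hv₀⟩
  rw [ContH1.conj_one_apply]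

/-- **Absolute values of the values**: at an anchored point with `Ü(y)² = −1`, every value `w` has
`‖w‖ = ‖q̈‖^{−a²} · ‖value_y(x)‖` for its degree `a`, and `w = ± value_y(x)` when `a = 0`.
[cite: MochizukiEtTh2009, Def 1.9 (ii) p.29] -/
theorem exists_norm_value_eq (hC : M.toThetaSetting.Compat)
    (h15ii : ThetaSetting.Prop15ii E.toKummerData hC) (h15iii : ThetaSetting.Prop15iii E hC)
    {x : M.toThetaSetting.H1 M.toThetaSetting.GtpYdd} (hx : x ∈ E.thetaClasses) (εZ : M.GtpC)
    (y : ThetaSetting.NonCuspidalPoint E.toKummerData)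
    (hc : (((y.coord : M.Kdd) : PadicAlgCl p)) ^ 2 = -1)
    (hL : y.evalAt (ContH1.res M.toTheta M.toThetaSetting.DeltaTheta y.Dpt_le
      (M.toThetaSetting.inflTheta M.toThetaSetting.GtpYdd E.logUdd)) = E.toKddHat y.coord)
    {v₀ : (↥M.Kdd)ˣ}
    (hv₀ : y.evalAt (ContH1.res M.toTheta M.toThetaSetting.DeltaTheta y.Dpt_le x) = E.toKddHat v₀)
    {w : (↥M.Kdd)ˣ} (hw : w ∈ valuesAt hC εZ x y) :
    ∃ a : ℤ, ‖((w : M.Kdd) : PadicAlgCl p)‖ =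
        ‖M.toThetaSetting.qdd ^ (-(a * a))‖ * ‖((v₀ : M.Kdd) : PadicAlgCl p)‖ ∧
      (a = 0 → ((w : M.Kdd) : PadicAlgCl p) = ((v₀ : M.Kdd) : PadicAlgCl p) ∨
        ((w : M.Kdd) : PadicAlgCl p) = -((v₀ : M.Kdd) : PadicAlgCl p)) := by
  obtain ⟨a, u, hu, hpm, h⟩ := exists_value_law hC h15ii h15iii hx εZ y hL hw
  rw [hv₀, ← map_mul] at h
  have hw' : w = v₀ * (y.coord ^ (-(2 * a)) * M.toThetaSetting.qddUnit ^ (-(a * a)) * u) :=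
    E.toKddHat_injective h
  have hcoe : ((w : M.Kdd) : PadicAlgCl p) =
      ((v₀ : M.Kdd) : PadicAlgCl p) * ((((y.coord : M.Kdd) : PadicAlgCl p)) ^ (-(2 * a)) *
        M.toThetaSetting.qdd ^ (-(a * a)) * ((u : M.Kdd) : PadicAlgCl p)) := by
    rw [hw', coe_units_mul, coe_units_mul, coe_units_mul, coe_units_zpow', coe_units_zpow']
    rfl
  refine ⟨a, ?_, fun ha => ?_⟩
  · rw [hcoe, norm_mul, norm_mul, norm_mul, norm_zpow, norm_eq_one_of_sq_eq_neg_one hc, one_zpow,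
      one_mul, show ‖((u : M.Kdd) : PadicAlgCl p)‖ = 1 from hu, mul_one, mul_comm]
  · subst ha
    rcases hpm rfl with h1 | h1 <;> [left; right] <;> rw [hcoe, h1] <;> simp

/-- **Standard type pins the value of `x` at one of the two points to `±1`**: the minimal-norm element
of a standard set of values is `± value_y(x)` (degree `0`), so `value_τ(x) = ±1` or `value_{τ⁻¹}(x) = ±1`.
Inputs: Prop. 1.5 (ii)(iii) (FACTS) and the anchor equations at `τ`, `τ⁻¹`.
[cite: MochizukiEtTh2009, Def 1.9 (ii) p.29] -/
theorem exists_value_eq_sign_at (hC : M.toThetaSetting.Compat)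
    (h15ii : ThetaSetting.Prop15ii E.toKummerData hC) (h15iii : ThetaSetting.Prop15iii E hC)
    {x : M.toThetaSetting.H1 M.toThetaSetting.GtpYdd} (hx : x ∈ E.thetaClasses) (εZ : M.GtpC)
    (y : ThetaSetting.NonCuspidalPoint E.toKummerData)
    (hc : (((y.coord : M.Kdd) : PadicAlgCl p)) ^ 2 = -1)
    (hL : y.evalAt (ContH1.res M.toTheta M.toThetaSetting.DeltaTheta y.Dpt_le
      (M.toThetaSetting.inflTheta M.toThetaSetting.GtpYdd E.logUdd)) = E.toKddHat y.coord)
    {v : (↥M.Kdd)ˣ} (hvV : v ∈ valuesAt hC εZ x y)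
    (hmin : ∀ w ∈ valuesAt hC εZ x y,
      ‖((v : M.Kdd) : PadicAlgCl p)‖ ≤ ‖((w : M.Kdd) : PadicAlgCl p)‖)
    (hpm : ((v : M.Kdd) : PadicAlgCl p) = 1 ∨ ((v : M.Kdd) : PadicAlgCl p) = -1) :
    ∃ v₀ : (↥M.Kdd)ˣ,
      y.evalAt (ContH1.res M.toTheta M.toThetaSetting.DeltaTheta y.Dpt_le x) = E.toKddHat v₀ ∧
      (((v₀ : M.Kdd) : PadicAlgCl p) = 1 ∨ ((v₀ : M.Kdd) : PadicAlgCl p) = -1) := by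
  obtain ⟨v₀, hv₀⟩ := exists_eval_eq_toKddHat hC h15ii h15iii hx εZ y hL hvV
  refine ⟨v₀, hv₀, ?_⟩
  have hle := hmin v₀ (mem_valuesAt_of_eval_eq hC εZ y hv₀)
  obtain ⟨a, hnorm, ha0⟩ := exists_norm_value_eq hC h15ii h15iii hx εZ y hc hL hv₀ hvV
  have hpos : 0 < ‖((v₀ : M.Kdd) : PadicAlgCl p)‖ := norm_pos_iff.mpr (coe_units_ne_zero v₀)
  rw [hnorm] at hle
  have hq : ‖M.toThetaSetting.qdd ^ (-(a * a))‖ ≤ 1 := by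
    by_contra hgt
    rw [not_le] at hgt
    nlinarith
  have ha : a = 0 := eq_zero_of_norm_qdd_zpow_le_one hq
  rcases ha0 ha with h1 | h1 <;> rw [h1] at hpm
  · exact hpm
  · rcases hpm with h2 | h2 <;> [right; left] <;> linear_combination -h2

variable (E) in
/-- Membership of the unit translate `κ(u)·η̈` in the torsor of theta classes (bookkeeping).
[cite: MochizukiEtTh2009, Prop 1.3 p.21] -/
theorem kum_mul_etaDd_mem_thetaClasses {u : (↥M.Kdd)ˣ} (hu : u ∈ M.toThetaSetting.unitsOKdd) :
    M.toThetaSetting.inflTheta M.toThetaSetting.GtpYdd (E.kumYdd (E.toKddHat u)) * E.etaDd ∈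
      E.thetaClasses :=
  ⟨_, ⟨E.toKddHat u, ⟨u, hu, rfl⟩, rfl⟩, rfl⟩

/-- **[EtTh] Thm. 1.10 (i), uniqueness clause, from Prop. 1.5 (iii) at the CLASS level** (row r8″):
the typed `Thm110iUnique hC hZ E S` — if `η̈^{Θ,ℤ}` and `(u·η̈)^{Θ,ℤ}`, `u ∈ O^×_K̈`, are both of standard
type then `u = ±1` — from: the FACTS Prop. 1.5 (ii) (`Prop15ii`, F-2503) and Prop. 1.5 (iii)
(`Prop15iii`, F-0591); the two ANCHOR equations «`log(Ü)|_τ` evaluates to `Ü(τ) = √−1`», «`log(Ü)|_{τ⁻¹}`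
evaluates to `Ü(τ⁻¹) = (√−1)⁻¹`»; and ONE sign relation between the values of `η̈` at the two points
(`Θ̈(−√−1) = −Θ̈(√−1)`, Prop. 1.4 (ii)).  No orbit generator, no evaluation naturality, no translated
points, no value law. [cite: MochizukiEtTh2009, Thm 1.10 (i) p.29] -/
theorem thm110iUnique_of_prop15iii (hC : M.toThetaSetting.Compat) {εZ : M.GtpC}
    (hZ : M.IsAdmissibleEpsZ εZ) (E : M.toThetaSetting.EtaleThetaData)
    (S : M.StandardData E.toKummerData)
    (h15ii : ThetaSetting.Prop15ii E.toKummerData hC) (h15iii : ThetaSetting.Prop15iii E hC)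
    (hτ : S.tau.evalAt (ContH1.res M.toTheta M.toThetaSetting.DeltaTheta S.tau.Dpt_le
      (M.toThetaSetting.inflTheta M.toThetaSetting.GtpYdd E.logUdd)) = E.toKddHat S.tau.coord)
    (hτ' : S.tauInv.evalAt (ContH1.res M.toTheta M.toThetaSetting.DeltaTheta S.tauInv.Dpt_le
      (M.toThetaSetting.inflTheta M.toThetaSetting.GtpYdd E.logUdd)) = E.toKddHat S.tauInv.coord)
    (hsym : ∃ w : (↥M.Kdd)ˣ, (((w : M.Kdd) : PadicAlgCl p) = 1 ∨ ((w : M.Kdd) : PadicAlgCl p) = -1) ∧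
      S.tauInv.evalAt (ContH1.res M.toTheta M.toThetaSetting.DeltaTheta S.tauInv.Dpt_le E.etaDd) =
        E.toKddHat w *
          S.tau.evalAt (ContH1.res M.toTheta M.toThetaSetting.DeltaTheta S.tau.Dpt_le E.etaDd)) :
    Thm110iUnique hC hZ E S := by
  intro u hu hstd hstd'
  have hq0 : M.toThetaSetting.qdd ≠ 0 := qdd_ne_zero
  -- coordinates of the two points: `Ü(τ)² = −1 = Ü(τ⁻¹)²`
  have hcτ : (((S.tau.coord : M.Kdd) : PadicAlgCl p)) ^ 2 = -1 := by
    rw [S.tau_coord]; exact S.sqrtNegOne_sq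
  have hcτ' : (((S.tauInv.coord : M.Kdd) : PadicAlgCl p)) ^ 2 = -1 := by
    rw [S.tauInv_coord, inv_pow, S.sqrtNegOne_sq, inv_neg, inv_one]
  have hx₁ : E.etaDd ∈ E.thetaClasses := E.etaDd_mem_thetaClasses
  have hx₂ := kum_mul_etaDd_mem_thetaClasses E hu
  obtain ⟨w, hwpm, hw⟩ := hsym
  -- Step 1: the values of `η̈` itself at BOTH points are `±1`
  have key : ∀ {x : M.toThetaSetting.H1 M.toThetaSetting.GtpYdd}, x ∈ E.thetaClasses →
      M.IsOfStandardType hC εZ S x →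
      (∃ v₀ : (↥M.Kdd)ˣ,
        S.tau.evalAt (ContH1.res M.toTheta M.toThetaSetting.DeltaTheta S.tau.Dpt_le x) =
          E.toKddHat v₀ ∧
        (((v₀ : M.Kdd) : PadicAlgCl p) = 1 ∨ ((v₀ : M.Kdd) : PadicAlgCl p) = -1)) ∨
      (∃ v₀ : (↥M.Kdd)ˣ,
        S.tauInv.evalAt (ContH1.res M.toTheta M.toThetaSetting.DeltaTheta S.tauInv.Dpt_le x) =
          E.toKddHat v₀ ∧
        (((v₀ : M.Kdd) : PadicAlgCl p) = 1 ∨ ((v₀ : M.Kdd) : PadicAlgCl p) = -1)) := by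
    intro x hx hst
    obtain ⟨V, hV, v, hvV, hmin, -, hpm⟩ := hst
    rcases hV with rfl | rfl
    · exact Or.inl (exists_value_eq_sign_at hC h15ii h15iii hx εZ S.tau hcτ hτ hvV hmin hpm)
    · exact Or.inr (exists_value_eq_sign_at hC h15ii h15iii hx εZ S.tauInv hcτ' hτ' hvV hmin hpm)
  have hη : ∃ t₁ t₂ : (↥M.Kdd)ˣ,
      S.tau.evalAt (ContH1.res M.toTheta M.toThetaSetting.DeltaTheta S.tau.Dpt_le E.etaDd) =
        E.toKddHat t₁ ∧
      (((t₁ : M.Kdd) : PadicAlgCl p) = 1 ∨ ((t₁ : M.Kdd) : PadicAlgCl p) = -1) ∧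
      S.tauInv.evalAt (ContH1.res M.toTheta M.toThetaSetting.DeltaTheta S.tauInv.Dpt_le E.etaDd) =
        E.toKddHat t₂ ∧
      (((t₂ : M.Kdd) : PadicAlgCl p) = 1 ∨ ((t₂ : M.Kdd) : PadicAlgCl p) = -1) := by
    rcases key hx₁ hstd with ⟨t₁, ht₁, hpm₁⟩ | ⟨t₂, ht₂, hpm₂⟩
    · refine ⟨t₁, w * t₁, ht₁, hpm₁, by rw [hw, ht₁, map_mul], ?_⟩
      rw [coe_units_mul]; exact sign_mul hwpm hpm₁
    · refine ⟨w⁻¹ * t₂, t₂, ?_, ?_, ht₂, hpm₂⟩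
      · rw [map_mul, map_inv, ← ht₂, hw, inv_mul_cancel_left]
      · rw [coe_units_mul, coe_units_inv']; exact sign_mul (sign_inv hwpm) hpm₂
  obtain ⟨t₁, t₂, ht₁, hpm₁, ht₂, hpm₂⟩ := hη
  -- Step 2: the values of `κ(u)·η̈` are `u ·` those of `η̈`; standard type gives `u · (±1) = ±1`
  rcases key hx₂ hstd' with ⟨v₂, hv₂, hpm'⟩ | ⟨v₂, hv₂, hpm'⟩
  · rw [S.tau.evalAt_res_kum_mul, ht₁, ← map_mul] at hv₂
    have h := congrArg (fun z : (↥M.Kdd)ˣ => ((z : M.Kdd) : PadicAlgCl p)) (E.toKddHat_injective hv₂)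
    simp only [coe_units_mul] at h
    rw [← h] at hpm'
    exact sign_of_mul_sign hpm₁ hpm'
  · rw [S.tauInv.evalAt_res_kum_mul, ht₂, ← map_mul] at hv₂
    have h := congrArg (fun z : (↥M.Kdd)ˣ => ((z : M.Kdd) : PadicAlgCl p)) (E.toKddHat_injective hv₂)
    simp only [coe_units_mul] at h
    rw [← h] at hpm'
    exact sign_of_mul_sign hpm₂ hpm'

end MuTwoSetting

end Literature.AnabelianGeometry.EtaleTheta

end
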